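import Literature.MathematicalPhysics.QuantumLattice.HeisenbergTorusSubadditivity
import Literature.MathematicalPhysics.QuantumLattice.AndersonHeisenbergStarBound
import HarnessLib

/-!
# The ground-state energy density of the Heisenberg antiferromagnet (thermodynamic limit)

Topic `MathematicalPhysics/QuantumLattice`; the spin-system counterpart of
`HubbardTorus2DEnergyDensity.lean` / `HubbardChainEnergyDensity.lean`. For the spin-`n/2`
Heisenberg model `H_L = J Σ_{⟨xy⟩} 𝐒_x·𝐒_y` on the tori `(ℤ/Lℤ)^d`
(`heisenbergHamiltonian n (torusGraph d L) J`) with `J ≥ 0` and `d ≥ 1`, the ground-state energy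
per site `E₀(H_L)/L^d` converges as `L → ∞`; the limit is `heisenbergEnergyDensity n d J`
(`tendsto_heisenbergEnergyDensity`). Proof: **Fekete's lemma along `d`-th powers**
(`ThermodynamicLimit.tendsto_of_tiling_of_filling_pow`, the `L^d` version of the tree's
`SquareTilingLimit.tendsto_of_tiling_of_filling`) fed by the tiling and filling inequalities of
`HeisenbergTorusSubadditivity.lean` and the a priori bound `E₀ ≥ -J S(S+1) d L^d`
(Ruelle, *Statistical Mechanics* (1969), §2.2).

What the limit is USED for (bundle `pub-mbboot`: certified moment-relaxation lower bounds for the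
Heisenberg chain and the square lattice in the thermodynamic limit, exact-diagonalisation enclosures
of finite tori):

* **the limit is an infimum up to the surface term** — `e ≤ E₀(H_M)/M^d + 2 J S(S+1) d / M` for
  every torus `M ≥ 3` (`heisenbergEnergyDensity_le`), so a certified UPPER bound on one finite torus
  bounds `e` from above (`heisenbergEnergyDensity_le_of_le`);
* **eventual torus-wise lower bounds pass to the limit** (`heisenbergEnergyDensity_ge_of_forall_ge`:
  the shape `∀ (L : ℕ) [NeZero L], L₀ ≤ L → q ≤ E₀(H_L)/L^d` of the bundle's rows gives `q ≤ e`);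
  in particular Anderson's torus bound gives `-(d+1)/4 ≤ e(1, d, 1)`
  (`heisenbergEnergyDensity_spinHalf_ge_anderson`, from `heisenbergAF_torus_groundEnergy_ge`);
* **window certificates bound the limit** — ONE identity in the spin algebra of a finite window
  `Λ' ⊂ ℤ^d` (the hypothesis `hcert` of the window theorems of `HeisenbergWindowCertificate.lean` /
  `HeisenbergWindowCertificateSquare.lean`) gives `c − Σₖ ‖aₖ‖ ≤ heisenbergEnergyDensity n d J`:
  every `d` with the affine family `x ↦ εx + v` (`heisenbergEnergyDensity_ge_of_window_certificate`),
  the square lattice with the full `D₄` space group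
  (`heisenbergEnergyDensity_two_ge_of_window_certificate_d4`), the chain
  (`heisenbergEnergyDensity_one_ge_of_window_certificate`).

Everything is proved; the only definitions are `heisenbergTorusEnergy` (the torus ground-state
energy as a function of `L : ℕ`, junk `0` at `L = 0`) and the `limUnder` `heisenbergEnergyDensity`.
No named facts.

## References

* D. Ruelle, *Statistical Mechanics: Rigorous Results* (Benjamin, 1969), §2.1–2.2 (thermodynamic
  limit by subadditivity; the limit is the infimum of the finite-volume densities up to surface terms).
* H. Tasaki, *Physics and Mathematics of Quantum Many-Body Systems* (Springer, 2020), §2.4–2.5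
  (the Heisenberg antiferromagnet; ground-state energy density).
* X. Han, *Quantum many-body bootstrap*, arXiv:2006.06002 (2020), §2 (translation-invariant
  bootstrap lower bounds in the thermodynamic limit).
* P. W. Anderson, *Limits on the energy of the antiferromagnetic ground state*, Phys. Rev. 83 (1951)
  1260.
-/

noncomputable section

open Filter Topology

/-! ### Fekete's lemma along `d`-th powers -/

namespace Literature.MathematicalPhysics.QuantumLattice.ThermodynamicLimit

/-- `x^{d+1} - y^{d+1} ≤ (d+1) x^d (x - y)` for `0 ≤ y ≤ x`. [folklore] -/
private theorem pow_succ_sub_pow_succ_le (x y : ℝ) (hy : 0 ≤ y) (hxy : y ≤ x) (d : ℕ) :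
    x ^ (d + 1) - y ^ (d + 1) ≤ (d + 1 : ℝ) * x ^ d * (x - y) := by
  induction d with
  | zero => simp
  | succ d ih =>
      have hx : 0 ≤ x := hy.trans hxy
      have hyx : y ^ (d + 1) ≤ x ^ (d + 1) := pow_le_pow_left₀ hy hxy _
      have hxd : 0 ≤ x ^ d := pow_nonneg hx d
      have h1 : x ^ (d + 1 + 1) - y ^ (d + 1 + 1) =
          x * (x ^ (d + 1) - y ^ (d + 1)) + (x - y) * y ^ (d + 1) := by ring
      rw [h1]
      have h2 : x * (x ^ (d + 1) - y ^ (d + 1)) ≤ x * ((d + 1 : ℝ) * x ^ d * (x - y)) :=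
        mul_le_mul_of_nonneg_left ih hx
      have h3 : (x - y) * y ^ (d + 1) ≤ (x - y) * x ^ (d + 1) :=
        mul_le_mul_of_nonneg_left hyx (by linarith)
      have h4 : x * ((d + 1 : ℝ) * x ^ d * (x - y)) + (x - y) * x ^ (d + 1) =
          ((d + 1 : ℕ) + 1 : ℝ) * x ^ (d + 1) * (x - y) := by
        push_cast; ring
      linarith

/-- `x^d - y^d ≤ d x^{d-1} (x - y)` for `0 ≤ y ≤ x` and `d ≥ 1`. [folklore] -/
private theorem pow_sub_pow_le (x y : ℝ) (hy : 0 ≤ y) (hxy : y ≤ x) {d : ℕ} (hd : 1 ≤ d) :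
    x ^ d - y ^ d ≤ (d : ℝ) * x ^ (d - 1) * (x - y) := by
  obtain ⟨d', rfl⟩ : ∃ d', d = d' + 1 := ⟨d - 1, by omega⟩
  have := pow_succ_sub_pow_succ_le x y hy hxy d'
  simpa using this

/-- **Fekete's lemma along `d`-th powers, with tiling defects and complement filling.** Let
`b : ℕ → ℝ` (an energy per site of the torus of side `L` in `d ≥ 1` dimensions) satisfy, for
`M ≥ M₀ ≥ 1`: (i) `b M ≥ -c`; (ii) tiling: `b((k+1)M) ≤ b(M) + C/M`; (iii) filling: for
`M₀ ≤ ℓ ≤ L`, `L^d b(L) ≤ ℓ^d b(ℓ) + C(L^d - ℓ^d + L^{d-1})`, with `C ≥ 0`. Then `b(L)` converges, to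
`e = inf_{M ≥ M₀} (b M + C/M)`; in particular `e ≤ b M + C/M` for every `M ≥ M₀`.
(Ruelle, *Statistical Mechanics* (1969), §2.1–2.2.) [folklore] -/
theorem tendsto_of_tiling_of_filling_pow {d : ℕ} (hd : 1 ≤ d) (b : ℕ → ℝ) {C c : ℝ} {M₀ : ℕ}
    (hM₀ : 1 ≤ M₀) (hC : 0 ≤ C) (hlow : ∀ M, M₀ ≤ M → -c ≤ b M)
    (htile : ∀ k M : ℕ, M₀ ≤ M → b ((k + 1) * M) ≤ b M + C / M)
    (hfill : ∀ ℓ L : ℕ, M₀ ≤ ℓ → ℓ ≤ L →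
      (L : ℝ) ^ d * b L ≤ (ℓ : ℝ) ^ d * b ℓ + C * ((L : ℝ) ^ d - (ℓ : ℝ) ^ d + (L : ℝ) ^ (d - 1))) :
    ∃ e : ℝ, Tendsto b atTop (𝓝 e) ∧ ∀ M, M₀ ≤ M → e ≤ b M + C / M := by
  -- the candidate limit
  set B : ℕ → ℝ := fun M => b M + C / M with hB
  set S : Set ℝ := B '' {M | M₀ ≤ M} with hS
  have hSne : S.Nonempty := ⟨B M₀, M₀, Set.mem_setOf.2 le_rfl, rfl⟩
  have hSbdd : BddBelow S := by
    refine ⟨-c, ?_⟩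
    rintro _ ⟨M, hM, rfl⟩
    have h1 := hlow M hM
    have h2 : 0 ≤ C / M := by positivity
    simp only [hB]; linarith
  set β := sInf S with hβ
  have hβle : ∀ M, M₀ ≤ M → β ≤ B M := fun M hM => csInf_le hSbdd ⟨M, hM, rfl⟩
  refine ⟨β, Metric.tendsto_atTop.2 fun ε hε => ?_, fun M hM => hβle M hM⟩
  -- choose `M` with `B M < β + ε/2`
  obtain ⟨_, ⟨M, hM, rfl⟩, hBM⟩ := exists_lt_of_csInf_lt hSne (lt_add_of_pos_right β (half_pos hε))
  have hM1 : 1 ≤ M := hM₀.trans hM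
  have hMpos : (0 : ℝ) < M := by exact_mod_cast hM1
  -- the error term `R/L`, `R = d M (|B M| + C) + C`
  set R : ℝ := d * M * (|B M| + C) + C with hR
  have hR0 : 0 ≤ R := by positivity
  obtain ⟨L₁, hL₁⟩ := exists_nat_gt (max (R / (ε / 2)) (C / (ε / 2)))
  refine ⟨max L₁ (max M 1), fun L hL => ?_⟩
  have hLL₁ : L₁ ≤ L := le_of_max_le_left hL
  have hLM : M ≤ L := le_of_max_le_left (le_of_max_le_right hL)
  have hL1 : 1 ≤ L := le_of_max_le_right (le_of_max_le_right hL)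
  have hLpos : (0 : ℝ) < L := by exact_mod_cast hL1
  have hLgt : max (R / (ε / 2)) (C / (ε / 2)) < L := hL₁.trans_le (by exact_mod_cast hLL₁)
  have hRL : R / L < ε / 2 := by
    rw [div_lt_iff₀ hLpos]
    have := (le_max_left _ _).trans_lt hLgt
    rw [div_lt_iff₀ (half_pos hε)] at this
    linarith
  have hCL : C / L < ε / 2 := by
    rw [div_lt_iff₀ hLpos]
    have := (le_max_right _ _).trans_lt hLgt
    rw [div_lt_iff₀ (half_pos hε)] at this
    linarith
  rw [Real.dist_eq, abs_sub_lt_iff]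
  constructor
  · -- upper bound: `b L ≤ B M + R / L`
    set k : ℕ := L / M with hk
    have hk1 : 1 ≤ k := (Nat.one_le_div_iff (hM₀.trans hM)).2 hLM
    set ℓ : ℕ := k * M with hℓ
    have hℓL : ℓ ≤ L := Nat.div_mul_le_self L M
    have hℓM : M ≤ ℓ := by
      calc M = 1 * M := (one_mul M).symm
        _ ≤ k * M := Nat.mul_le_mul_right M hk1
    have hM₀ℓ : M₀ ≤ ℓ := hM.trans hℓM
    have hLℓ : L - ℓ < M := by
      have := Nat.div_add_mod' L M
      have h2 : L % M < M := Nat.mod_lt L (hM₀.trans hM)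
      rw [hℓ, hk]
      omega
    -- tiling at `ℓ = k M`
    have ht : b ℓ ≤ B M := by
      obtain ⟨k', hk'⟩ : ∃ k', k = k' + 1 := ⟨k - 1, by omega⟩
      rw [hℓ, hk']
      exact htile k' M hM
    -- filling from `ℓ` to `L`
    have hf := hfill ℓ L hM₀ℓ hℓL
    have hℓpos : (0 : ℝ) ≤ ℓ := by positivity
    have hℓL' : (ℓ : ℝ) ≤ L := by exact_mod_cast hℓL
    have hLd : (L : ℝ) ^ d = (L : ℝ) ^ (d - 1) * L := by
      rw [← pow_succ]; congr 1; omega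
    have hLd1 : (0 : ℝ) ≤ (L : ℝ) ^ (d - 1) := by positivity
    have hgap0 : (0 : ℝ) ≤ (L : ℝ) ^ d - (ℓ : ℝ) ^ d :=
      sub_nonneg.2 (pow_le_pow_left₀ hℓpos hℓL' d)
    have hgap : (L : ℝ) ^ d - (ℓ : ℝ) ^ d ≤ (L : ℝ) ^ (d - 1) * (d * M) := by
      have h1 : (L : ℝ) - ℓ ≤ M := by
        have : ((L - ℓ : ℕ) : ℝ) < M := by exact_mod_cast hLℓ
        rw [Nat.cast_sub hℓL] at this
        exact this.le
      have h2 := pow_sub_pow_le (L : ℝ) ℓ hℓpos hℓL' hd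
      have h3 : (d : ℝ) * (L : ℝ) ^ (d - 1) * ((L : ℝ) - ℓ) ≤ (d : ℝ) * (L : ℝ) ^ (d - 1) * M :=
        mul_le_mul_of_nonneg_left h1 (by positivity)
      nlinarith
    -- `ℓ^d b ℓ ≤ ℓ^d B M ≤ L^d B M + (L^d - ℓ^d)|B M|`
    have h1 : (ℓ : ℝ) ^ d * b ℓ ≤ (L : ℝ) ^ d * B M + ((L : ℝ) ^ d - (ℓ : ℝ) ^ d) * |B M| := by
      have h2 : (ℓ : ℝ) ^ d * b ℓ ≤ (ℓ : ℝ) ^ d * B M := mul_le_mul_of_nonneg_left ht (by positivity)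
      have h3 : (ℓ : ℝ) ^ d * B M = (L : ℝ) ^ d * B M - ((L : ℝ) ^ d - (ℓ : ℝ) ^ d) * B M := by ring
      have h4 : -(((L : ℝ) ^ d - (ℓ : ℝ) ^ d) * B M) ≤ ((L : ℝ) ^ d - (ℓ : ℝ) ^ d) * |B M| := by
        rw [← mul_neg]
        exact mul_le_mul_of_nonneg_left (neg_le_abs _) hgap0
      linarith
    have h5 : (L : ℝ) ^ d * b L ≤ (L : ℝ) ^ d * B M + (L : ℝ) ^ (d - 1) * R := by
      have h6 : ((L : ℝ) ^ d - (ℓ : ℝ) ^ d) * (|B M| + C) ≤ (L : ℝ) ^ (d - 1) * (d * M) * (|B M| + C) :=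
        mul_le_mul_of_nonneg_right hgap (by positivity)
      have h7 : (L : ℝ) ^ (d - 1) * R =
          (L : ℝ) ^ (d - 1) * (d * M) * (|B M| + C) + C * (L : ℝ) ^ (d - 1) := by
        simp only [hR]; ring
      nlinarith [h1, hf, h6, h7, hgap0, hC]
    have h8 : b L ≤ B M + R / L := by
      have hL2 : (0 : ℝ) < (L : ℝ) ^ d := by positivity
      have key : (L : ℝ) ^ d * b L ≤ (L : ℝ) ^ d * (B M + R / L) := by
        have : (L : ℝ) ^ d * (B M + R / L) = (L : ℝ) ^ d * B M + (L : ℝ) ^ (d - 1) * R := by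
          rw [hLd]; field_simp
        rw [this]; exact h5
      exact le_of_mul_le_mul_left key hL2
    linarith
  · -- lower bound: `β ≤ B L = b L + C/L`
    have h1 := hβle L (hM.trans hLM)
    simp only [hB] at h1
    linarith

end Literature.MathematicalPhysics.QuantumLattice.ThermodynamicLimit


open Matrix Complex Finset Literature.Probability.LatticeModels
open Literature.MathematicalPhysics.QuantumManyBody.StateRelaxation
open scoped ComplexOrder BigOperators

namespace Literature.MathematicalPhysics.QuantumLattice

/-! ### The thermodynamic limit of the ground-state energy density -/

section Limit

variable {d : ℕ}

/-- The ground-state energy `E₀(H_L)` of the spin-`n/2` Heisenberg model `J Σ_{⟨xy⟩} 𝐒_x·𝐒_y` on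
the torus `(ℤ/Lℤ)^d`, as a function of `L : ℕ` (junk value `0` at `L = 0`, where the torus is not
finite). [folklore] -/
def heisenbergTorusEnergy (n d : ℕ) (J : ℝ) (L : ℕ) : ℝ :=
  if h : L = 0 then 0 else
    haveI : NeZero L := ⟨h⟩
    (heisenbergHamiltonian n (torusGraph d L) J).groundEnergy

/-- For `L ≠ 0`, `heisenbergTorusEnergy` is the ground-state energy of `H_L`. [folklore] -/
theorem heisenbergTorusEnergy_eq (n d : ℕ) (J : ℝ) (L : ℕ) [NeZero L] :
    heisenbergTorusEnergy n d J L = (heisenbergHamiltonian n (torusGraph d L) J).groundEnergy := by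
  rw [heisenbergTorusEnergy, dif_neg (NeZero.ne L)]

/-- **The ground-state energy density of the Heisenberg antiferromagnet on `ℤ^d`**,
`e(n, d, J) = lim_{L→∞} E₀(H_L)/L^d` along the tori `(ℤ/Lℤ)^d` (`H_L = J Σ_{⟨xy⟩} 𝐒_x·𝐒_y`, spin
`n/2`). A `limUnder`; the limit exists for `J ≥ 0`, `d ≥ 1` (`tendsto_heisenbergEnergyDensity`).
Ruelle (1969) §2.2 (thermodynamic limit of lattice systems by subadditivity over boxes).
[cite: Ruelle1969, §2.2] -/
def heisenbergEnergyDensity (n d : ℕ) (J : ℝ) : ℝ :=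
  limUnder atTop (fun L : ℕ => heisenbergTorusEnergy n d J L / (L : ℝ) ^ d)

/-- The three Fekete hypotheses for `b(L) = E₀(H_L)/L^d`, and the limit with its finite-size upper
bound. [folklore] -/
theorem exists_tendsto_heisenbergTorusEnergy_div (n : ℕ) (hd : 1 ≤ d) {J : ℝ} (hJ : 0 ≤ J) :
    ∃ e : ℝ, Tendsto (fun L : ℕ => heisenbergTorusEnergy n d J L / (L : ℝ) ^ d) atTop (𝓝 e) ∧
      ∀ M : ℕ, 3 ≤ M → e ≤ heisenbergTorusEnergy n d J M / (M : ℝ) ^ d +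
        (2 * J * casimirValue n * d) / M := by
  have hc := casimirValue_nonneg n
  have hC : 0 ≤ 2 * J * casimirValue n * d := by positivity
  refine ThermodynamicLimit.tendsto_of_tiling_of_filling_pow hd _ (C := 2 * J * casimirValue n * d)
    (c := J * casimirValue n * d) (M₀ := 3) (by norm_num) hC ?_ ?_ ?_
  · -- a priori lower bound
    intro M hM
    haveI : NeZero M := ⟨by omega⟩
    have hMpos : (0 : ℝ) < (M : ℝ) ^ d := by positivity
    rw [heisenbergTorusEnergy_eq, le_div_iff₀ hMpos]
    have h := heisenbergTorus_groundEnergy_ge (d := d) n hM hJ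
    linarith
  · -- tiling
    intro k M hM
    haveI : NeZero M := ⟨by omega⟩
    have hMpos : (0 : ℝ) < M := by exact_mod_cast (show 0 < M by omega)
    have hMd : (0 : ℝ) < (M : ℝ) ^ d := by positivity
    have hkpos : (0 : ℝ) < ((k + 1 : ℕ) : ℝ) := by positivity
    rw [heisenbergTorusEnergy_eq, heisenbergTorusEnergy_eq]
    have htile := heisenbergTorus_groundEnergy_tiling (d := d) n hJ (k + 1) M hM
    have hpow : (((k + 1) * M : ℕ) : ℝ) ^ d = ((k + 1 : ℕ) : ℝ) ^ d * (M : ℝ) ^ d := by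
      rw [Nat.cast_mul, mul_pow]
    rw [hpow, div_le_iff₀ (by positivity)]
    have hMd1 : (M : ℝ) ^ d = (M : ℝ) ^ (d - 1) * M := by
      rw [← pow_succ]; congr 1; omega
    have key : (Matrix.groundEnergy (heisenbergHamiltonian n (torusGraph d M) J) / (M : ℝ) ^ d +
        2 * J * casimirValue n * d / M) * (((k + 1 : ℕ) : ℝ) ^ d * (M : ℝ) ^ d) =
        ((k + 1 : ℕ) : ℝ) ^ d * (Matrix.groundEnergy (heisenbergHamiltonian n (torusGraph d M) J) +
          2 * J * casimirValue n * d * (M : ℝ) ^ (d - 1)) := by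
      rw [hMd1]
      field_simp
    rw [key]
    exact htile
  · -- filling
    intro ℓ L hℓ hℓL
    haveI : NeZero ℓ := ⟨by omega⟩
    haveI : NeZero L := ⟨by omega⟩
    have hℓ0 : (0 : ℝ) < ℓ := by exact_mod_cast (show 0 < ℓ by omega)
    have hL0 : (0 : ℝ) < L := by exact_mod_cast (show 0 < L by omega)
    have hℓpos : (0 : ℝ) < (ℓ : ℝ) ^ d := pow_pos hℓ0 d
    have hLpos : (0 : ℝ) < (L : ℝ) ^ d := pow_pos hL0 d
    rw [heisenbergTorusEnergy_eq, heisenbergTorusEnergy_eq, mul_div_cancel₀ _ hLpos.ne',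
      mul_div_cancel₀ _ hℓpos.ne']
    have hfill := heisenbergTorus_groundEnergy_filling (d := d) (ℓ := ℓ) (L := L) n hJ hℓ hℓL
    have hℓL' : (ℓ : ℝ) ≤ L := by exact_mod_cast hℓL
    have hpow1 : (ℓ : ℝ) ^ (d - 1) ≤ (L : ℝ) ^ (d - 1) := pow_le_pow_left₀ (by positivity) hℓL' _
    have hgap : (0 : ℝ) ≤ (L : ℝ) ^ d - (ℓ : ℝ) ^ d :=
      sub_nonneg.2 (pow_le_pow_left₀ (by positivity) hℓL' d)
    have hJc : 0 ≤ J * casimirValue n * d := by positivity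
    nlinarith [hfill, mul_le_mul_of_nonneg_left hpow1 hJc, mul_nonneg hJc hgap]

/-- **Existence of the thermodynamic limit** of the ground-state energy density of the spin-`n/2`
Heisenberg antiferromagnet (`J ≥ 0`) along the tori `(ℤ/Lℤ)^d`, `d ≥ 1`:
`E₀(H_L)/L^d → e(n, d, J)`. Proof: Fekete's lemma along `d`-th powers
(`ThermodynamicLimit.tendsto_of_tiling_of_filling_pow`) fed by the tiling inequality
(`heisenbergTorus_groundEnergy_tiling`: block product states) and the filling inequality
(`heisenbergTorus_groundEnergy_filling`: a small torus ground state extended by a reference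
configuration), with the a priori bound `E₀ ≥ -J S(S+1) d L^d`. Ruelle (1969) §2.2.
[cite: Ruelle1969, §2.2] -/
theorem tendsto_heisenbergEnergyDensity (n : ℕ) (hd : 1 ≤ d) {J : ℝ} (hJ : 0 ≤ J) :
    Tendsto (fun L : ℕ => heisenbergTorusEnergy n d J L / (L : ℝ) ^ d) atTop
      (𝓝 (heisenbergEnergyDensity n d J)) := by
  obtain ⟨e, he, -⟩ := exists_tendsto_heisenbergTorusEnergy_div n hd hJ
  exact tendsto_nhds_limUnder ⟨e, he⟩

/-- The same limit written with the Hamiltonians (eventually `L ≠ 0`). [cite: Ruelle1969, §2.2] -/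
theorem tendsto_heisenbergEnergyDensity' (n : ℕ) (hd : 1 ≤ d) {J : ℝ} (hJ : 0 ≤ J) :
    Tendsto (fun L : ℕ => (heisenbergHamiltonian n (torusGraph d (L + 1)) J).groundEnergy /
      ((L + 1 : ℕ) : ℝ) ^ d) atTop (𝓝 (heisenbergEnergyDensity n d J)) := by
  have h := (tendsto_heisenbergEnergyDensity n hd hJ).comp (tendsto_add_atTop_nat 1)
  refine h.congr fun L => ?_
  simp only [Function.comp_apply, heisenbergTorusEnergy_eq]

/-- **The limit is an infimum up to the surface term**: for every torus `M ≥ 3`,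
`e ≤ E₀(H_M)/M^d + 2 J S(S+1) d / M` (tile `(ℤ/kMℤ)^d` by the `M`-blocks and let `k → ∞`). So a
certified UPPER bound on one finite torus is a certified upper bound on the thermodynamic limit.
Ruelle (1969) §2.2. [cite: Ruelle1969, §2.2] -/
theorem heisenbergEnergyDensity_le (n : ℕ) (hd : 1 ≤ d) {J : ℝ} (hJ : 0 ≤ J) (M : ℕ) [NeZero M]
    (hM : 3 ≤ M) :
    heisenbergEnergyDensity n d J ≤
      (heisenbergHamiltonian n (torusGraph d M) J).groundEnergy / (M : ℝ) ^ d +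
        2 * J * casimirValue n * d / M := by
  obtain ⟨e, he, hle⟩ := exists_tendsto_heisenbergTorusEnergy_div n hd hJ
  have heq : heisenbergEnergyDensity n d J = e :=
    tendsto_nhds_unique (tendsto_nhds_limUnder ⟨e, he⟩) he
  rw [heq, ← heisenbergTorusEnergy_eq]
  exact hle M hM

/-- A certified upper bound `E₀(H_M) ≤ B` on one torus `M ≥ 3` bounds the limit:
`e ≤ B/M^d + 2 J S(S+1) d / M`. [cite: Ruelle1969, §2.2] -/
theorem heisenbergEnergyDensity_le_of_le (n : ℕ) (hd : 1 ≤ d) {J : ℝ} (hJ : 0 ≤ J) (M : ℕ) [NeZero M]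
    (hM : 3 ≤ M) {B : ℝ} (h : (heisenbergHamiltonian n (torusGraph d M) J).groundEnergy ≤ B) :
    heisenbergEnergyDensity n d J ≤ B / (M : ℝ) ^ d + 2 * J * casimirValue n * d / M := by
  have hMd : (0 : ℝ) < (M : ℝ) ^ d := by positivity
  exact (heisenbergEnergyDensity_le n hd hJ M hM).trans (by gcongr)

/-- **Eventual torus-wise lower bounds pass to the limit**: if `q ≤ E₀(H_L)/L^d` for all large `L`,
then `q ≤ e` — the logical form of the bundle's torus-wise rows
`∀ (L : ℕ) [NeZero L], L₀ ≤ L → q ≤ groundEnergy (heisenbergHamiltonian n (torusGraph d L) J) / L^d`.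
[cite: Ruelle1969, §2.2] -/
theorem heisenbergEnergyDensity_ge_of_forall_ge (n : ℕ) (hd : 1 ≤ d) {J : ℝ} (hJ : 0 ≤ J) {q : ℝ}
    (L₀ : ℕ) (h : ∀ (L : ℕ) [NeZero L], L₀ ≤ L →
      q ≤ (heisenbergHamiltonian n (torusGraph d L) J).groundEnergy / (L : ℝ) ^ d) :
    q ≤ heisenbergEnergyDensity n d J := by
  refine ge_of_tendsto (tendsto_heisenbergEnergyDensity n hd hJ) ?_
  filter_upwards [eventually_ge_atTop (max L₀ 1)] with L hL
  haveI : NeZero L := ⟨by have := le_of_max_le_right hL; omega⟩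
  rw [heisenbergTorusEnergy_eq]
  exact h L (le_of_max_le_left hL)

/-- **Anderson's bound in the thermodynamic limit** (spin `½`, `J = 1`, every `d ≥ 1`):
`-(d+1)/4 ≤ e(1, d, 1)`, from the tree's torus-wise theorem `heisenbergAF_torus_groundEnergy_ge`
(`E₀(H_L) ≥ -((d+1)/4) L^d` for every `L ≥ 3`) and `heisenbergEnergyDensity_ge_of_forall_ge`. In
`d = 2` this is the printed floor `e ≥ -3/4` per site that the certified square-lattice rows of the
bundle improve. [cite: Anderson1951] -/
theorem heisenbergEnergyDensity_spinHalf_ge_anderson (hd : 1 ≤ d) :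
    -(((d : ℝ) + 1) / 4) ≤ heisenbergEnergyDensity 1 d 1 := by
  refine heisenbergEnergyDensity_ge_of_forall_ge 1 hd zero_le_one 3 fun L _ hL => ?_
  have hL0 : (0 : ℝ) < (L : ℝ) ^ d := pow_pos (by exact_mod_cast (show 0 < L by omega)) d
  rw [le_div_iff₀ hL0]
  have h := heisenbergAF_torus_groundEnergy_ge (d := d) L hL
  linarith

end Limit

/-! ### Window certificates bound the thermodynamic limit -/

section WindowLimit

/-- **Window certificate ⇒ lower bound on the thermodynamic-limit energy density, every `d ≥ 1`**
(symmetry family `x ↦ εx + v`): the data and the identity `hcert` of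
`heisenbergLattice_groundEnergy_div_ge_of_window_certificate` (`HeisenbergWindowCertificateSquare.lean`)
give `c − Σₖ ‖aₖ‖ ≤ E₀(H_L)/L^d` on every torus `L ≥ 3` with `x ↦ x mod L` injective on `Λ'`, hence
(`exists_forall_le_injOn_proj`) on all large tori, and `heisenbergEnergyDensity_ge_of_forall_ge`
passes to the limit: `c − Σₖ ‖aₖ‖ ≤ heisenbergEnergyDensity n d J` (`J ≥ 0`). This is the literal
thermodynamic-limit statement of a translation-invariant (reduce-mode) bootstrap certificate
(Han 2020 §2). [cite: Han2020Bootstrap, §2] [cite: Ruelle1969, §2.2] -/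
theorem heisenbergEnergyDensity_ge_of_window_certificate {d : ℕ} (hd : 1 ≤ d) (n : ℕ) {J : ℝ}
    (hJ : 0 ≤ J)
    {Λ Λ' : Finset (Site d)} (hΛ : Λ ⊆ Λ')
    (hclosed : ∀ x ∈ Λ, ∀ i : Fin d, x + unitVec i ∈ Λ' ∧ x - unitVec i ∈ Λ')
    (hz : (0 : Site d) ∈ Λ') (he : ∀ i : Fin d, (unitVec i : Site d) ∈ Λ')
    {m : Type*} [Fintype m] [DecidableEq m] {Λm : Matrix m m ℂ} (hΛm : Λm.PosSemidef)
    (O : m → Op ↥Λ' (n + 1))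
    {κ : Type*} (s : Finset κ) (B : κ → Op ↥Λ (n + 1))
    {ι : Type*} (tt : Finset ι) (ε : ι → ℤˣ) (v : ι → Site d)
    (hsh : ∀ l, affShiftSet (ε l) (v l) Λ ⊆ Λ') (Y : ι → Op ↥Λ (n + 1))
    {ρ : Type*} (u : Finset ρ) (b : ρ → ℂ) (W : ρ → Op ↥Λ' (n + 1)) (mq : ρ → ℂ)
    (hmq : ∀ j ∈ u, mq j ≠ 0)
    (hW : ∀ j ∈ u, totalSpin n 2 * W j - W j * totalSpin n 2 = mq j • W j)
    {δ : Type*} (ah : Finset δ) (dc : δ → ℝ) (V : δ → Op ↥Λ' (n + 1))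
    {κ'' : Type*} (w : Finset κ'') (a : κ'' → ℂ) (M : κ'' → Op ↥Λ' (n + 1))
    (hM : ∀ k ∈ w, (M k).IsContraction) {c : ℝ}
    (hcert : (J : ℂ) • (∑ i : Fin d, spinDot n (⟨0, hz⟩ : ↥Λ') ⟨unitVec i, he i⟩) -
        (c : ℂ) • (1 : Op ↥Λ' (n + 1)) =
      gramForm Λm O +
        (∑ k ∈ s, (heisenbergHamiltonian n (windowGraph Λ') J * spinEmbed (siteIncl hΛ) (B k) -
            spinEmbed (siteIncl hΛ) (B k) * heisenbergHamiltonian n (windowGraph Λ') J) +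
          ∑ l ∈ tt, (spinEmbed (siteIncl (hsh l)) (spinEmbed (siteAffEmb (ε l) (v l) Λ) (Y l)) -
            spinEmbed (siteIncl hΛ) (Y l)) +
          ∑ j ∈ u, b j • W j) +
        (∑ m' ∈ ah, ((dc m' : ℝ) : ℂ) • ((V m')ᴴ - V m') + ∑ k ∈ w, a k • M k)) :
    c - ∑ k ∈ w, ‖a k‖ ≤ heisenbergEnergyDensity n d J := by
  obtain ⟨L₀, hL₀⟩ := exists_forall_le_injOn_proj Λ'
  refine heisenbergEnergyDensity_ge_of_forall_ge n hd hJ (max L₀ 3) fun L _ hL => ?_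
  have hL3 : 3 ≤ L := le_trans (le_max_right _ _) hL
  have hLL : L₀ ≤ L := le_trans (le_max_left _ _) hL
  exact heisenbergLattice_groundEnergy_div_ge_of_window_certificate n J hL3 hΛ hclosed hz he
    (hL₀ L hLL) hΛm O s B tt ε v hsh Y u b W mq hmq hW ah dc V w a M hM hcert

/-- **Square lattice, full space group** (`d = 2`, symmetry family `x ↦ γx + w`, `γ ∈ D₄`): the data
and the identity `hcert` of `heisenbergSquare_groundEnergy_div_ge_of_window_certificate_d4` give
`c − Σₖ ‖aₖ‖ ≤ heisenbergEnergyDensity n 2 J` (`J ≥ 0`) — the shape of the bundle's certified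
square-lattice Heisenberg rows as ONE inequality on the thermodynamic-limit energy density.
[cite: Han2020Bootstrap, §2] [cite: Ruelle1969, §2.2] -/
theorem heisenbergEnergyDensity_two_ge_of_window_certificate_d4 (n : ℕ) {J : ℝ} (hJ : 0 ≤ J)
    {Λ Λ' : Finset (Site 2)} (hΛ : Λ ⊆ Λ')
    (hclosed : ∀ x ∈ Λ, ∀ i : Fin 2, x + unitVec i ∈ Λ' ∧ x - unitVec i ∈ Λ')
    (hz : (0 : Site 2) ∈ Λ') (he : ∀ i : Fin 2, (unitVec i : Site 2) ∈ Λ')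
    {m : Type*} [Fintype m] [DecidableEq m] {Λm : Matrix m m ℂ} (hΛm : Λm.PosSemidef)
    (O : m → Op ↥Λ' (n + 1))
    {κ : Type*} (s : Finset κ) (B : κ → Op ↥Λ (n + 1))
    {ι : Type*} (tt : Finset ι) (γ : ι → DihedralGroup 4) (wv : ι → Site 2)
    (hsh : ∀ l, d4ShiftSet (γ l) (wv l) Λ ⊆ Λ') (Y : ι → Op ↥Λ (n + 1))
    {ρ : Type*} (u : Finset ρ) (b : ρ → ℂ) (W : ρ → Op ↥Λ' (n + 1)) (mq : ρ → ℂ)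
    (hmq : ∀ j ∈ u, mq j ≠ 0)
    (hW : ∀ j ∈ u, totalSpin n 2 * W j - W j * totalSpin n 2 = mq j • W j)
    {δ : Type*} (ah : Finset δ) (dc : δ → ℝ) (V : δ → Op ↥Λ' (n + 1))
    {κ'' : Type*} (w : Finset κ'') (a : κ'' → ℂ) (M : κ'' → Op ↥Λ' (n + 1))
    (hM : ∀ k ∈ w, (M k).IsContraction) {c : ℝ}
    (hcert : (J : ℂ) • (∑ i : Fin 2, spinDot n (⟨0, hz⟩ : ↥Λ') ⟨unitVec i, he i⟩) -
        (c : ℂ) • (1 : Op ↥Λ' (n + 1)) =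
      gramForm Λm O +
        (∑ k ∈ s, (heisenbergHamiltonian n (windowGraph Λ') J * spinEmbed (siteIncl hΛ) (B k) -
            spinEmbed (siteIncl hΛ) (B k) * heisenbergHamiltonian n (windowGraph Λ') J) +
          ∑ l ∈ tt, (spinEmbed (siteIncl (hsh l)) (spinEmbed (siteD4Emb (γ l) (wv l) Λ) (Y l)) -
            spinEmbed (siteIncl hΛ) (Y l)) +
          ∑ j ∈ u, b j • W j) +
        (∑ m' ∈ ah, ((dc m' : ℝ) : ℂ) • ((V m')ᴴ - V m') + ∑ k ∈ w, a k • M k)) :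
    c - ∑ k ∈ w, ‖a k‖ ≤ heisenbergEnergyDensity n 2 J := by
  obtain ⟨L₀, hL₀⟩ := exists_forall_le_injOn_proj Λ'
  refine heisenbergEnergyDensity_ge_of_forall_ge n (by norm_num) hJ (max L₀ 3) fun L _ hL => ?_
  have hL3 : 3 ≤ L := le_trans (le_max_right _ _) hL
  have hLL : L₀ ≤ L := le_trans (le_max_left _ _) hL
  exact heisenbergSquare_groundEnergy_div_ge_of_window_certificate_d4 n J hL3 hΛ hclosed hz he
    (hL₀ L hLL) hΛm O s B tt γ wv hsh Y u b W mq hmq hW ah dc V w a M hM hcert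

/-- **Chain** (`d = 1`): the data and the identity `hcert` of
`heisenbergChain_groundEnergy_div_ge_of_window_certificate` (`HeisenbergWindowCertificate.lean`)
give `c − Σₖ ‖aₖ‖ ≤ heisenbergEnergyDensity n 1 J` (`J ≥ 0`) — the bundle's certified
Heisenberg-chain thermodynamic-limit rows as ONE inequality (Bethe/Hulthén value `¼ − ln 2` for
`n = J = 1` is the comparison, not used). [cite: Han2020Bootstrap, §2] [cite: Ruelle1969, §2.2] -/
theorem heisenbergEnergyDensity_one_ge_of_window_certificate (n : ℕ) {J : ℝ} (hJ : 0 ≤ J)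
    {Λ Λ' : Finset (Site 1)} (hΛ : Λ ⊆ Λ')
    (hclosed : ∀ x ∈ Λ, ∀ i : Fin 1, x + unitVec i ∈ Λ' ∧ x - unitVec i ∈ Λ')
    (hz : (0 : Site 1) ∈ Λ') (he : (unitVec 0 : Site 1) ∈ Λ')
    {m : Type*} [Fintype m] [DecidableEq m] {Λm : Matrix m m ℂ} (hΛm : Λm.PosSemidef)
    (O : m → Op ↥Λ' (n + 1))
    {κ : Type*} (s : Finset κ) (B : κ → Op ↥Λ (n + 1))
    {ι : Type*} (tt : Finset ι) (ε : ι → ℤˣ) (v : ι → Site 1)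
    (hsh : ∀ l, affShiftSet (ε l) (v l) Λ ⊆ Λ') (Y : ι → Op ↥Λ (n + 1))
    {ρ : Type*} (u : Finset ρ) (b : ρ → ℂ) (W : ρ → Op ↥Λ' (n + 1)) (mq : ρ → ℂ)
    (hmq : ∀ j ∈ u, mq j ≠ 0)
    (hW : ∀ j ∈ u, totalSpin n 2 * W j - W j * totalSpin n 2 = mq j • W j)
    {δ : Type*} (ah : Finset δ) (dc : δ → ℝ) (V : δ → Op ↥Λ' (n + 1))
    {κ'' : Type*} (w : Finset κ'') (a : κ'' → ℂ) (M : κ'' → Op ↥Λ' (n + 1))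
    (hM : ∀ k ∈ w, (M k).IsContraction) {c : ℝ}
    (hcert : (J : ℂ) • spinDot n (⟨0, hz⟩ : ↥Λ') ⟨unitVec 0, he⟩ - (c : ℂ) • (1 : Op ↥Λ' (n + 1)) =
      gramForm Λm O +
        (∑ k ∈ s, (heisenbergHamiltonian n (windowGraph Λ') J * spinEmbed (siteIncl hΛ) (B k) -
            spinEmbed (siteIncl hΛ) (B k) * heisenbergHamiltonian n (windowGraph Λ') J) +
          ∑ l ∈ tt, (spinEmbed (siteIncl (hsh l)) (spinEmbed (siteAffEmb (ε l) (v l) Λ) (Y l)) -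
            spinEmbed (siteIncl hΛ) (Y l)) +
          ∑ j ∈ u, b j • W j) +
        (∑ m' ∈ ah, ((dc m' : ℝ) : ℂ) • ((V m')ᴴ - V m') + ∑ k ∈ w, a k • M k)) :
    c - ∑ k ∈ w, ‖a k‖ ≤ heisenbergEnergyDensity n 1 J := by
  obtain ⟨L₀, hL₀⟩ := exists_forall_le_injOn_proj Λ'
  refine heisenbergEnergyDensity_ge_of_forall_ge n le_rfl hJ (max L₀ 3) fun L _ hL => ?_
  have hL3 : 3 ≤ L := le_trans (le_max_right _ _) hL
  have hLL : L₀ ≤ L := le_trans (le_max_left _ _) hL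
  rw [pow_one]
  exact heisenbergChain_groundEnergy_div_ge_of_window_certificate n J hL3 hΛ hclosed hz he
    (hL₀ L hLL) hΛm O s B tt ε v hsh Y u b W mq hmq hW ah dc V w a M hM hcert

end WindowLimit

end Literature.MathematicalPhysics.QuantumLattice
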